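import Mathlib.LinearAlgebra.Matrix.Trace
import Mathlib.LinearAlgebra.Matrix.ConjTranspose
import Mathlib.LinearAlgebra.Matrix.NonsingularInverse
import Mathlib.Analysis.Complex.Basic
import Literature.MathematicalPhysics.QuantumFieldTheory.ConstructiveQFTWave0
import HarnessLib

/-!
# Venture YMGap — Theorem C (sharp Hessian constant `4d`), kernel part T1.3:
# the lattice Bochner identity and `Σ_p γ_p ≥ -4|X|²`

HONEST FRAMING: venture file (cell `pub-ymgap`, track (a), item A2 = "Theorem C" of
`p2/HESSIAN-SHARP.md`). It kernel-checks Lemma 1 / Corollary 1 of HESSIAN-SHARP §1 (the "gauge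
identity", target T1.3 of `p2/LEAN-TARGETS-A2.md`) on the periodic lattice `(ℤ/Lℤ)^d` of the tree's
`ConstructiveQFTWave0` (`Site d L = Fin d → ZMod L`, edges `(x, μ)` from `x` to `x + e_μ`), in the
following SUM-OF-SQUARES form found while porting (equivalent to HESSIAN-SHARP (1.1) + Cor. 1):

  `Σ_{plaquettes p} γ_p(Q,X) + 4|X|² = Σ_v |D*_Q X(v)|² + Σ_v Σ_μ |X̂⁺_μ(v) - X̂⁻_μ(v)|² ≥ 0`.

Here, for link variables `Q_e` with `Q_eᴴ Q_e = 1` and tangent directions `X_e ∈ M_N(ℂ)` (no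
anti-Hermiticity is needed for this identity), `⟨A,B⟩ = Re tr(A Bᴴ)`, `|A|² = ⟨A,A⟩`,
`X̂⁺_μ(v) = X_{(v,μ)}` (outgoing edge), `X̂⁻_μ(v) = -Q_eᴴ X_e Q_e` for the incoming edge
`e = (v - e_μ, μ)` (HESSIAN-SHARP §0 "vertex frames"), `D*_Q X(v) = Σ_μ (X̂⁺_μ(v) + X̂⁻_μ(v))`, and
`γ_p` is the CORNER form (1.1) of HESSIAN-SHARP:
`γ_{(x;μ,ν)} = 2⟨X̂⁺_μ(x),X̂⁺_ν(x)⟩ + 2⟨X̂⁻_μ(x+e_μ),X̂⁺_ν(x+e_μ)⟩ + 2⟨X̂⁻_ν(x+e_μ+e_ν),X̂⁻_μ(x+e_μ+e_ν)⟩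
  + 2⟨X̂⁺_μ(x+e_ν),X̂⁻_ν(x+e_ν)⟩`.
Proof: re-index each corner sum by its vertex (translations are bijections of the torus), so that
`Σ_x γ_{(x;μ,ν)} = 2 Σ_v ⟨Z_μ(v), Z_ν(v)⟩` with `Z_μ = X̂⁺_μ + X̂⁻_μ` for EVERY ordered pair `(μ,ν)`
(`sum_gammaCorner_eq`); sum over `μ ≠ ν`, use `Σ_{μ,ν}⟨Z_μ,Z_ν⟩ = |Σ_μ Z_μ|²` and the parallelogram law
`|Z_μ|² + |X̂⁺_μ - X̂⁻_μ|² = 2|X̂⁺_μ|² + 2|X̂⁻_μ|²`, and `Σ_v Σ_μ |X̂^±_μ(v)|² = |X|²`.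
Valid for every `L ≥ 1` and `d` (degenerate small tori included; the cell states Theorem C for `L ≥ 2`).

Main results: `latticeBochner` (the identity, with the plaquette sum written over ORDERED pairs of
distinct directions, `½ Σ_x Σ_{μ≠ν} γ_{(x;μ,ν)}` — `γ` is symmetric in `(μ,ν)`, so this is the sum
over the plaquettes `{μ<ν}`; the re-indexing to the tree's `Plaquette d L` is done where Theorem C
is assembled), `half_sum_gammaCorner_ge` (Cor. 1: that sum is `≥ -4|X|²`).
Reference: `run/shared/lean/pub/pub-ymgap/p2/HESSIAN-SHARP.md` §1; `p2/LEAN-TARGETS-A2.md` T1.3.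
-/

noncomputable section

namespace Summit.Ventures.YMGap.HessianSharp

open ComplexConjugate Complex Matrix Finset
open Literature.MathematicalPhysics.QuantumFieldTheory (Site Edge Plaquette)

variable {N : ℕ}

/-! ### The real inner product `⟨A,B⟩ = Re tr(A Bᴴ)` on `M_N(ℂ)` -/

/-- `⟨A,B⟩ = Re tr(A Bᴴ)` (the Hilbert–Schmidt inner product; on `𝔲(N)` it is `-Re tr(AB)`). -/
def ip (A B : Matrix (Fin N) (Fin N) ℂ) : ℝ := ((A * Bᴴ).trace).re

/-- `|A|² = ⟨A,A⟩`. -/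
def nsq (A : Matrix (Fin N) (Fin N) ℂ) : ℝ := ip A A

/-- `⟨A,B⟩ = ⟨B,A⟩`. -/
theorem ip_comm (A B : Matrix (Fin N) (Fin N) ℂ) : ip A B = ip B A := by
  unfold ip
  have h : B * Aᴴ = (A * Bᴴ)ᴴ := by rw [conjTranspose_mul, conjTranspose_conjTranspose]
  rw [h, Matrix.trace_conjTranspose, Complex.star_def, Complex.conj_re]

/-- Additivity in the first slot. -/
theorem ip_add_left (A B C : Matrix (Fin N) (Fin N) ℂ) : ip (A + B) C = ip A C + ip B C := by
  simp [ip, Matrix.add_mul, Matrix.trace_add]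

/-- Additivity in the second slot. -/
theorem ip_add_right (A B C : Matrix (Fin N) (Fin N) ℂ) : ip A (B + C) = ip A B + ip A C := by
  simp [ip, conjTranspose_add, Matrix.mul_add, Matrix.trace_add]

/-- `⟨-A,B⟩ = -⟨A,B⟩`. -/
theorem ip_neg_left (A B : Matrix (Fin N) (Fin N) ℂ) : ip (-A) B = -ip A B := by
  simp [ip]

/-- `⟨A,-B⟩ = -⟨A,B⟩`. -/
theorem ip_neg_right (A B : Matrix (Fin N) (Fin N) ℂ) : ip A (-B) = -ip A B := by
  simp [ip, conjTranspose_neg]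

/-- Subtraction in the first slot. -/
theorem ip_sub_left (A B C : Matrix (Fin N) (Fin N) ℂ) : ip (A - B) C = ip A C - ip B C := by
  rw [sub_eq_add_neg, ip_add_left, ip_neg_left, ← sub_eq_add_neg]

/-- Subtraction in the second slot. -/
theorem ip_sub_right (A B C : Matrix (Fin N) (Fin N) ℂ) : ip A (B - C) = ip A B - ip A C := by
  rw [sub_eq_add_neg, ip_add_right, ip_neg_right, ← sub_eq_add_neg]

/-- Finite sums in the first slot. -/
theorem ip_sum_left {ι : Type*} (s : Finset ι) (f : ι → Matrix (Fin N) (Fin N) ℂ)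
    (B : Matrix (Fin N) (Fin N) ℂ) : ip (∑ i ∈ s, f i) B = ∑ i ∈ s, ip (f i) B := by
  classical
  induction s using Finset.induction_on with
  | empty => simp [ip]
  | insert a s ha ih => rw [Finset.sum_insert ha, Finset.sum_insert ha, ip_add_left, ih]

/-- Finite sums in the second slot. -/
theorem ip_sum_right {ι : Type*} (s : Finset ι) (A : Matrix (Fin N) (Fin N) ℂ)
    (f : ι → Matrix (Fin N) (Fin N) ℂ) : ip A (∑ i ∈ s, f i) = ∑ i ∈ s, ip A (f i) := by
  rw [ip_comm, ip_sum_left]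
  exact Finset.sum_congr rfl fun i _ => ip_comm _ _

/-- `|Σ_i Z_i|² = Σ_i Σ_j ⟨Z_i, Z_j⟩`. -/
theorem nsq_sum {ι : Type*} (s : Finset ι) (f : ι → Matrix (Fin N) (Fin N) ℂ) :
    nsq (∑ i ∈ s, f i) = ∑ i ∈ s, ∑ j ∈ s, ip (f i) (f j) := by
  unfold nsq
  rw [ip_sum_left]
  exact Finset.sum_congr rfl fun i _ => ip_sum_right _ _ _

/-- Parallelogram law: `|A + B|² + |A - B|² = 2|A|² + 2|B|²`. -/
theorem nsq_add_add_nsq_sub (A B : Matrix (Fin N) (Fin N) ℂ) :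
    nsq (A + B) + nsq (A - B) = 2 * nsq A + 2 * nsq B := by
  simp only [nsq, ip_add_left, ip_add_right, ip_sub_left, ip_sub_right]
  ring

/-- `|A|² = Σ_{a,b} |A_{ab}|² ≥ 0`. -/
theorem nsq_eq_sum_normSq (A : Matrix (Fin N) (Fin N) ℂ) : nsq A = ∑ a, ∑ b, normSq (A a b) := by
  unfold nsq ip Matrix.trace
  rw [Complex.re_sum]
  refine Finset.sum_congr rfl fun a _ => ?_
  rw [Matrix.diag_apply, Matrix.mul_apply, Complex.re_sum]
  refine Finset.sum_congr rfl fun b _ => ?_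
  rw [conjTranspose_apply, Complex.star_def, Complex.mul_conj, Complex.ofReal_re]

/-- `|A|² ≥ 0`. -/
theorem nsq_nonneg (A : Matrix (Fin N) (Fin N) ℂ) : 0 ≤ nsq A := by
  rw [nsq_eq_sum_normSq]
  exact Finset.sum_nonneg fun a _ => Finset.sum_nonneg fun b _ => normSq_nonneg _

/-- `|-A|² = |A|²`. -/
theorem nsq_neg (A : Matrix (Fin N) (Fin N) ℂ) : nsq (-A) = nsq A := by
  simp [nsq, ip_neg_left, ip_neg_right]

/-- Transport by a unitary is an isometry: `|Qᴴ X Q|² = |X|²` for `Qᴴ Q = 1`. -/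
theorem nsq_unitary_conj {Q : Matrix (Fin N) (Fin N) ℂ} (hQ : Qᴴ * Q = 1)
    (X : Matrix (Fin N) (Fin N) ℂ) : nsq (Qᴴ * X * Q) = nsq X := by
  have hQ' : Q * Qᴴ = 1 := mul_eq_one_comm.1 hQ
  unfold nsq ip
  rw [conjTranspose_mul, conjTranspose_mul, conjTranspose_conjTranspose]
  have : Qᴴ * X * Q * (Qᴴ * (Xᴴ * Q)) = Qᴴ * (X * Xᴴ) * Q := by
    calc Qᴴ * X * Q * (Qᴴ * (Xᴴ * Q)) = Qᴴ * X * (Q * Qᴴ) * (Xᴴ * Q) := by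
          simp only [Matrix.mul_assoc]
      _ = Qᴴ * (X * Xᴴ) * Q := by rw [hQ']; simp only [Matrix.mul_one, Matrix.mul_assoc]
  rw [this, Matrix.trace_mul_cycle, hQ', Matrix.one_mul]

/-! ### Vertex frames on the torus `(ℤ/Lℤ)^d` -/

section Lattice

variable {d L : ℕ} [NeZero L]
variable (Q X : Edge d L → Matrix (Fin N) (Fin N) ℂ)

/-- The unit lattice vector `e_μ`. -/
def unitVec (μ : Fin d) : Site d L := Pi.single μ 1

omit [NeZero L] in
/-- The tree's `Site.shift` is translation by `unitVec`. -/
theorem shift_eq (x : Site d L) (μ : Fin d) : x.shift μ = x + unitVec μ := rfl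

/-- `X̂⁺_μ(v) = X_{(v,μ)}`: the outgoing edge in direction `μ`, read at its start `v`. -/
def xPlus (v : Site d L) (μ : Fin d) : Matrix (Fin N) (Fin N) ℂ := X (v, μ)

/-- `X̂⁻_μ(v) = -Q_eᴴ X_e Q_e` for the incoming edge `e = (v - e_μ, μ)`, read at its end `v`
(HESSIAN-SHARP §0: `X̂_e(v(e)) = -Ad(Q_e⁻¹) X_e`). -/
def xMinus (v : Site d L) (μ : Fin d) : Matrix (Fin N) (Fin N) ℂ :=
  -((Q (v - unitVec μ, μ))ᴴ * X (v - unitVec μ, μ) * Q (v - unitVec μ, μ))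

/-- `Z_μ(v) = X̂⁺_μ(v) + X̂⁻_μ(v)`. -/
def zField (v : Site d L) (μ : Fin d) : Matrix (Fin N) (Fin N) ℂ := xPlus X v μ + xMinus Q X v μ

/-- The covariant divergence `D*_Q X(v) = Σ_{e ∋ v} X̂_e(v) = Σ_μ Z_μ(v)`. -/
def covDiv (v : Site d L) : Matrix (Fin N) (Fin N) ℂ := ∑ μ, zField Q X v μ

/-- **The corner form `γ_p`** of the plaquette `p = (x; μ, ν)` (HESSIAN-SHARP (1.1)): the four
corner pairings of consecutive (orthogonal) edges of `p`, each read in the frame of its corner. -/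
def gammaCorner (x : Site d L) (μ ν : Fin d) : ℝ :=
  2 * ip (xPlus X x μ) (xPlus X x ν) +
    2 * ip (xMinus Q X (x + unitVec μ) μ) (xPlus X (x + unitVec μ) ν) +
    2 * ip (xMinus Q X (x + unitVec μ + unitVec ν) ν) (xMinus Q X (x + unitVec μ + unitVec ν) μ) +
    2 * ip (xPlus X (x + unitVec ν) μ) (xMinus Q X (x + unitVec ν) ν)

/-- `|X|² = Σ_e |X_e|²`. -/
def fieldNormSq : ℝ := ∑ e : Edge d L, nsq (X e)

/-- **Re-indexing by corners**: for every ORDERED pair of directions,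
`Σ_x γ_{(x;μ,ν)} = 2 Σ_v ⟨Z_μ(v), Z_ν(v)⟩`. -/
theorem sum_gammaCorner_eq (μ ν : Fin d) :
    ∑ x : Site d L, gammaCorner Q X x μ ν =
      2 * ∑ v : Site d L, ip (zField Q X v μ) (zField Q X v ν) := by
  simp only [gammaCorner, Finset.sum_add_distrib, ← Finset.mul_sum, zField, ip_add_left,
    ip_add_right]
  -- the four corner sums, each re-indexed by its vertex
  have h2 : ∑ x : Site d L, ip (xMinus Q X (x + unitVec μ) μ) (xPlus X (x + unitVec μ) ν) =
      ∑ v : Site d L, ip (xMinus Q X v μ) (xPlus X v ν) :=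
    Fintype.sum_equiv (Equiv.addRight (unitVec μ)) _ _ fun x => rfl
  have h3 : ∑ x : Site d L, ip (xMinus Q X (x + unitVec μ + unitVec ν) ν)
        (xMinus Q X (x + unitVec μ + unitVec ν) μ) =
      ∑ v : Site d L, ip (xMinus Q X v μ) (xMinus Q X v ν) := by
    rw [Fintype.sum_equiv (Equiv.addRight (unitVec μ + unitVec ν))
      (fun x => ip (xMinus Q X (x + unitVec μ + unitVec ν) ν) (xMinus Q X (x + unitVec μ + unitVec ν) μ))
      (fun v => ip (xMinus Q X v ν) (xMinus Q X v μ)) fun x => by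
        simp only [Equiv.coe_addRight, add_assoc]]
    exact Finset.sum_congr rfl fun v _ => ip_comm _ _
  have h4 : ∑ x : Site d L, ip (xPlus X (x + unitVec ν) μ) (xMinus Q X (x + unitVec ν) ν) =
      ∑ v : Site d L, ip (xPlus X v μ) (xMinus Q X v ν) :=
    Fintype.sum_equiv (Equiv.addRight (unitVec ν)) _ _ fun x => rfl
  rw [h2, h3, h4]
  ring

/-- `Σ_v Σ_μ |X̂⁺_μ(v)|² = |X|²`. -/
theorem sum_nsq_xPlus : ∑ v : Site d L, ∑ μ, nsq (xPlus X v μ) = fieldNormSq X := by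
  unfold fieldNormSq xPlus
  rw [Fintype.sum_prod_type]

/-- `Σ_v Σ_μ |X̂⁻_μ(v)|² = |X|²` (transport is an isometry, `v ↦ v - e_μ` a bijection). -/
theorem sum_nsq_xMinus (hQ : ∀ e, (Q e)ᴴ * Q e = 1) :
    ∑ v : Site d L, ∑ μ, nsq (xMinus Q X v μ) = fieldNormSq X := by
  unfold fieldNormSq xMinus
  rw [Fintype.sum_prod_type, Finset.sum_comm]
  conv_rhs => rw [Finset.sum_comm]
  refine Finset.sum_congr rfl fun μ _ => ?_
  simp only [nsq_neg, nsq_unitary_conj (hQ _)]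
  exact Fintype.sum_equiv (Equiv.subRight (unitVec μ)) _ _ fun v => rfl

/-- **The lattice Bochner identity** (HESSIAN-SHARP Lemma 1 + Cor. 1 in sum-of-squares form): with
the plaquette sum written over ordered pairs of distinct directions (each plaquette twice),
`½ Σ_x Σ_{μ≠ν} γ_{(x;μ,ν)} + 4|X|² = Σ_v |D*_Q X(v)|² + Σ_v Σ_μ |X̂⁺_μ(v) - X̂⁻_μ(v)|²`. -/
theorem latticeBochner (hQ : ∀ e, (Q e)ᴴ * Q e = 1) :
    (1 / 2) * ∑ x : Site d L, ∑ μ, ∑ ν, (if μ = ν then 0 else gammaCorner Q X x μ ν) +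
        4 * fieldNormSq X =
      ∑ v : Site d L, nsq (covDiv Q X v) +
        ∑ v : Site d L, ∑ μ, nsq (xPlus X v μ - xMinus Q X v μ) := by
  -- Σ_x Σ_μ Σ_ν (if μ = ν then 0 else γ) = Σ_μ Σ_ν [Σ_x γ] - Σ_μ [Σ_x γ(μ,μ)]
  have hsplit : ∑ x : Site d L, ∑ μ, ∑ ν, (if μ = ν then 0 else gammaCorner Q X x μ ν) =
      ∑ μ, ∑ ν, (2 * ∑ v : Site d L, ip (zField Q X v μ) (zField Q X v ν)) -
        ∑ μ, (2 * ∑ v : Site d L, ip (zField Q X v μ) (zField Q X v μ)) := by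
    rw [Finset.sum_comm]
    simp only [← sum_gammaCorner_eq]
    rw [← Finset.sum_sub_distrib]
    refine Finset.sum_congr rfl fun μ _ => ?_
    rw [Finset.sum_comm]
    rw [show ∑ x : Site d L, gammaCorner Q X x μ μ =
        ∑ ν, if μ = ν then ∑ x : Site d L, gammaCorner Q X x μ ν else 0 by simp]
    rw [← Finset.sum_sub_distrib]
    refine Finset.sum_congr rfl fun ν _ => ?_
    split_ifs with h
    · subst h; simp
    · simp
  -- |D v|² = Σ_μ Σ_ν ⟨Z_μ, Z_ν⟩
  have hD : ∀ v : Site d L, nsq (covDiv Q X v) = ∑ μ, ∑ ν, ip (zField Q X v μ) (zField Q X v ν) :=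
    fun v => nsq_sum _ _
  -- parallelogram + the two |X|² identities
  have hpar : ∀ (v : Site d L) μ, ip (zField Q X v μ) (zField Q X v μ) +
      nsq (xPlus X v μ - xMinus Q X v μ) = 2 * nsq (xPlus X v μ) + 2 * nsq (xMinus Q X v μ) :=
    fun v μ => nsq_add_add_nsq_sub _ _
  have hP := sum_nsq_xPlus X (d := d) (L := L)
  have hM := sum_nsq_xMinus Q X hQ
  -- bookkeeping with `S μ ν := Σ_v ⟨Z_μ(v), Z_ν(v)⟩`
  set S : Fin d → Fin d → ℝ := fun μ ν => ∑ v : Site d L, ip (zField Q X v μ) (zField Q X v ν)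
    with hS
  have hsplit' : ∑ x : Site d L, ∑ μ, ∑ ν, (if μ = ν then 0 else gammaCorner Q X x μ ν) =
      2 * ∑ μ, ∑ ν, S μ ν - 2 * ∑ μ, S μ μ := by
    rw [hsplit, Finset.mul_sum, Finset.mul_sum]
    simp only [Finset.mul_sum, hS]
  have hDsum : ∑ v : Site d L, nsq (covDiv Q X v) = ∑ μ, ∑ ν, S μ ν := by
    simp only [hD, hS]
    rw [Finset.sum_comm]
    exact Finset.sum_congr rfl fun μ _ => Finset.sum_comm
  have hdiag : ∑ v : Site d L, ∑ μ, ip (zField Q X v μ) (zField Q X v μ) = ∑ μ, S μ μ := by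
    simp only [hS]
    exact Finset.sum_comm
  have h3 : ∑ v : Site d L, ∑ μ, ip (zField Q X v μ) (zField Q X v μ) +
      ∑ v : Site d L, ∑ μ, nsq (xPlus X v μ - xMinus Q X v μ) = 4 * fieldNormSq X := by
    rw [← Finset.sum_add_distrib]
    have hv : ∀ v : Site d L, ∑ μ, ip (zField Q X v μ) (zField Q X v μ) +
        ∑ μ, nsq (xPlus X v μ - xMinus Q X v μ) =
        2 * ∑ μ, nsq (xPlus X v μ) + 2 * ∑ μ, nsq (xMinus Q X v μ) := fun v => by
      rw [← Finset.sum_add_distrib, Finset.mul_sum, Finset.mul_sum, ← Finset.sum_add_distrib]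
      exact Finset.sum_congr rfl fun μ _ => hpar v μ
    simp only [hv, Finset.sum_add_distrib, ← Finset.mul_sum, hP, hM]
    ring
  rw [hsplit', hDsum]
  linarith

/-- **Corollary 1 (ordered-pair form)**: `½ Σ_x Σ_{μ≠ν} γ_{(x;μ,ν)} ≥ -4|X|²`. -/
theorem half_sum_gammaCorner_ge (hQ : ∀ e, (Q e)ᴴ * Q e = 1) :
    -(4 * fieldNormSq X) ≤
      (1 / 2) * ∑ x : Site d L, ∑ μ, ∑ ν, (if μ = ν then 0 else gammaCorner Q X x μ ν) := by
  have h := latticeBochner Q X hQ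
  have h0 : 0 ≤ ∑ v : Site d L, nsq (covDiv Q X v) +
      ∑ v : Site d L, ∑ μ, nsq (xPlus X v μ - xMinus Q X v μ) :=
    add_nonneg (Finset.sum_nonneg fun v _ => nsq_nonneg _)
      (Finset.sum_nonneg fun v _ => Finset.sum_nonneg fun μ _ => nsq_nonneg _)
  linarith

end Lattice

end Summit.Ventures.YMGap.HessianSharp
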